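import Literature.NumberTheory.EllipticCurves.Kim2026.ShaLengthRankZeroLowerBound
import Literature.NumberTheory.EllipticCurves.Kim2026.ShaLengthRankZeroUpperBound
import Summits.BirchSwinnertonDyer.Rank1Residual.X4.KuriharaClasswide
import Summits.BirchSwinnertonDyer.Rank1Residual.Supersingular.SignedRankZero
import Summits.BirchSwinnertonDyer.Rank1Residual.AdditivePotMult.RankZeroChiBranchPrimeFacts
import Summits.BirchSwinnertonDyer.Rank1Residual.Additive.GordRankZeroKatoComponentTower
import HarnessLib

/-!
# Classes X3/X4 at `p ≥ 5`, rank `0`: the LOWER half of `BSD(E,p)` per pair from a Kurihara number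
# BEYOND THE UNIT CASE (Kim 2026 Thm. 1.8 (6) at level `p^k`), and the vanishing of all Kurihara
# numbers below the Tamagawa level (cell `b2b-bsdres`, team n1011, row T-N10K, seat `b2b-bsdres-n1011-p11`)

HONEST FRAMING (run/shared/lean/b2b/bsd-rank1-residual/, verbatim in every file): the goal of the
cell is to DELETE the COMBINATION-SHAPED residual classes of the Birch–Swinnerton-Dyer formula for
ALL analytic-rank `≤ 1` elliptic curves over `ℚ` — "full BSD formula for every rank `≤ 1` curve in
class `C`" assembled STRICTLY from published theorems — so that the rank-`≤ 1` remainder becomes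
exactly the CONSTRUCTION-SHAPED classes, which are TYPED (missing-input `Prop`s), NOT attempted.
This is not "finishing BSD". Team n1011 (N10 / N11): prove what is provable now; shrink each hard
class to its core with data; no claim beyond stated classes. Research route; X4 stays
CONSTRUCTION-SHAPED; the RESIDUAL-MAP marks of N10 / N11 are UNCHANGED by this file; nothing booked.

THEOREMS ONLY (no definition, no named fact); PER PAIR (a certificate shape), not a class theorem.

## What this file does

RESIDUAL-MAP §I **N10** asks, on X3 ∪ X4 ∧ `r_an = 0` at a potentially multiplicative (M) or
potentially good ordinary (G-ord) additive prime, for the LOWER half `ord_p #Ш_an(E) ≤ ord_p #Ш(E)`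
(`Typed.MissingLowerBoundAt W p`); the UPPER half there is a kernel theorem (sub-cells additive-p1 /
additive-p2: `ClassX4M.missingUpperBoundAt_rankZero_of_surj`,
`ClassX4Gord.missingUpperBoundAt_rankZero_of_katoComponent_of_towerSurj`). Per pair, sub-cell
additive-p3's Kurihara route (`X4/KuriharaClasswide.lean`) closes a rank-`0` X4 pair at `p ≥ 5` from
ONE UNIT Kurihara number `δ̃_n ≢ 0 (mod p)` — and proves that on the Tamagawa-obstructed rows
(`p ∣ ∏ c_ℓ`) NO unit Kurihara number exists once `BSD(E,p)` holds
(`not_kuriharaUnitAt_of_bsdp_of_dvd_tamagawaProduct`): there the route was EMPTY.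

The named fact `Kim2026.rankZero_le_padicValNat_sha_of_kuriharaNumber_ne_zero` (file
`Literature/…/Kim2026/ShaLengthRankZeroLowerBound.lean`, this seat, p249207; C.-H. Kim, Amer. J.
Math. 148 (2026) Thm. 1.8 (6) = arXiv:2203.12159v4 Thm. 1.9 (6) with §1.5.1, weaker than print)
reads clause (6) BEYOND the unit case: a Kurihara number NON-ZERO MODULO `p^k` at a level
`n ∈ 𝒩_k` gives `∂^{(∞)}(δ̃) ≤ k − 1`, hence `ord_p(L(E,1)/Ω_E) ≤ ord_p #Ш(E)(p) + (k − 1)` — ANY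
reduction type, `p ≥ 5`, `ρ̄` onto, Manin datum prime to `p`. Here:

* §1 `padicValRat_shaAn_le_of_kimLower`, **`missingLowerBoundAt_rankZero_of_kimLower`**: a
  certificate of level `k ≤ ord_p ∏ c_ℓ + 1` yields the LOWER half `Typed.MissingLowerBoundAt W p`
  (torsion term killed by `ρ̄` onto ⇒ `E[p]` irreducible); with ANY upper half, `BSD(E,p)`
  (`bsdp_rankZero_of_kimLower_of_missingUpperBoundAt`).
* §2 **`kuriharaNumber_eq_zero_of_missingUpperBoundAt_of_le_tamagawa`** — the KERNEL PREDICTION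
  for the census (CLASS-CLOSURE-PLAN §3.1/§3.2 STEP-0, instrument I-12): granted the UPPER half,
  EVERY Kurihara number of level `k ≤ ord_p ∏ c_ℓ` VANISHES modulo `p^k` (the level-`k` form of
  additive-p3's `k = 1` theorem); on X4(M) and on (G-ord, `e = 2`) the upper half is a kernel theorem,
  so the prediction is unconditional in the named facts there (`ClassX4M.kuriharaNumber_eq_zero_…`,
  `ClassX4Gord.kuriharaNumber_eq_zero_…`).
* §3 `padicValRat_eq_of_kimLower_one_of_kimUpper` — sanity: at `k = 1` the new fact and Kim's
  certificate-free upper bound return the conclusion of the unit fact.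
* §4 class readings on N10's loci at `p ≥ 5`: **`ClassX4M.bsdp_rankZero_of_kimLower`** (X4(M) ∧
  `r_an = 0` ∧ surj(p), Tamagawa-obstructed rows included — upper half from additive-p1's
  `ClassX4M.bsdp_rankZero_of_surj_of_lower`) and **`ClassX4Gord.bsdp_rankZero_of_kimLower`**
  ((G-ord) ∧ `e = 2`, upper half from additive-p2's `ClassX4Gord.bsdp_rankZero_of_katoComponent_of_lower`).

Corroboration of the reading in print (PREPRINT, not used): C.-H. Kim – R. Pollack, arXiv:2505.09121
§8.1.2, on 20787.e1 at `p = 3`: "Due to the non-trivial Tamagawa defect, `δ̃_n` vanishes mod 3 for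
every `n ∈ 𝒩_1`. Since `37, 1783 ∈ 𝒩_2` and `ord_3(δ̃_{37·1783} mod 9) = 1`, we still have
`Ш(E/ℚ)[3^∞] ≅ (ℤ/9ℤ)^{⊕2}`" — exactly §2 (vanishing at level `1 ≤ t`) and §1 (a level-`t + 1`
certificate). Nothing at `p = 3` is claimed (Kim 2026 is printed for `p ≥ 5`; `p = 3` = rows T-a2 / T-a4).

Census (this seat, `HOME/b2b-bsdres-n1011-p11/census/n10k_targets_p11.{py,json,md}`, SHA256SUMS;
S-b v4f `RESIDUE.jsonl` 94a3b5a5… + Cremona allbsd + rmap-2's `corner_cells_rmap2g6` imported;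
pure count, nothing booked): X4 ∧ `r_an = 0` ∧ `p ≥ 5` ∧ surj(p): 22 446 pairs; LOWER half
non-trivial (`p ∣ #Ш_an`): 1 178, of which Tamagawa defect `t = ord_p ∏ c_ℓ ≥ 1` — the rows only a
level-`(t+1)` certificate reaches —: 21 (all `t = 1`, `#Ш_an = p²`; (M) 10: 123300n1, 128800d1,
173850bj1, 181300bi1, 225550d1, 354725c1, 392550bd1, 464550dg1, 491550y1 @5, 280280bn1 @7; (G-ord,
`e = 2`) 1: 301350ed1 @5; (G-ord, `e ∈ {3,4,6}`) 2; (G)∧ss 1; (t′) 7), and `t = 0` (unit route):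
1 157; the §2 prediction bears on the 5 112 X4(M) ∪ (G-ord, `e = 2`) rows with `t ≥ 1` and
`p ∤ #Ш_an` (3 835 + 1 277) plus the 11 LOWER ones. Context `p = 3` (where this file proves nothing):
of the 192 277 X4@3 ∧ r0 ∧ surj(3) pairs, LOWER 7 394 (959 with `t ≥ 1`), and 40 761 unit-`Ш_an`
rows with `t ≥ 1`.

References: [Kim2022StructureSelmer] Thm. 1.9 (6), §1.5.1–1.5.3; [Kim2025RefinedTNC] §8.1.2 (PRE);
[Delbourgo1998] Prop. 4; [Wuthrich2014] Lemma 20, Cor. 19; [Kato2004Asterisque] Thm. 17.4 (3); [Miller2011LMS] Def. 1.1.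
-/

noncomputable section

open scoped Classical MatrixGroups ModularForm

open CongruenceSubgroup WeierstrassCurve Literature.NumberTheory.EllipticCurves
  Literature.NumberTheory.EllipticCurves.ModularForms
  Literature.NumberTheory.EllipticCurves.Rank1Residual
  Literature.NumberTheory.EllipticCurves.Rank1Residual.Typed
  Summit.BirchSwinnertonDyer.Rank1Residual.Supersingular
  Summit.BirchSwinnertonDyer.Rank1Residual.AdditivePotMult
  Summit.BirchSwinnertonDyer.Rank1Residual.Additive

namespace Summit.BirchSwinnertonDyer.Rank1Residual.X4

variable (W : WeierstrassCurve ℚ) [W.IsElliptic] [W.IsGloballyMinimal] (p : ℕ) [hp : Fact p.Prime]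

/-! ### §1 The LOWER half from a level-`k` Kurihara number -/

/-- **The raw reading of a level-`k` Kurihara number, rank `0`, `p ≥ 5`, ANY reduction at `p`**
(Kim 2026 Thm. 1.8 (6) beyond the unit case, named fact `hKim`; GZK `hGZK`): `W` globally minimal,
`ρ̄_{E,p}` onto, `L(E,1) ≠ 0`, a modular parametrisation datum `D` with `p ∤ c_D`, the period transfer
`Ω(W) = u·Ω⁺_f`, a level `n ∈ 𝒩_k` with cyclic reductions, surjective discrete logarithms `ψ` mod `p^k`
and `kuriharaNumber D.f (p^k) n ψ ≠ 0`. Then `#Ш_an = q ∈ ℚ` with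
`ord_p q + ord_p ∏ c_ℓ ≤ ord_p #Ш + (k − 1)` (`#Ш_an = (L(E,1)/Ω)·#T²/∏c_ℓ`, `p ∤ #T` by
irreducibility). Per pair. [cite: Kim2022StructureSelmer, Thm. 1.9 (6) (PDF p. 8) and §1.5.1 (PDF p. 7)]
[cite: Miller2011LMS, Def. 1.1] -/
theorem padicValRat_shaAn_le_of_kimLower
    (hKim : Kim2026.rankZero_le_padicValNat_sha_of_kuriharaNumber_ne_zero)
    (hGZK : rank_eq_analyticRank_of_analyticRank_le_one) (hp5 : 5 ≤ p)
    (hsurj : Surj W p) (hL : W.entireLFunction 1 ≠ 0)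
    {N : ℕ} [NeZero N] (D : ModularParametrizationData W N) (hc : ¬ (p : ℤ) ∣ D.maninConstant)
    (hper : ∃ u : ℚ, ‖(u : ℚ_[p])‖ = 1 ∧ W.realPeriodRat = u * plusPeriod D.f)
    (k n : ℕ) [NeZero n] (hk : 1 ≤ k) (hn : Kato.IsKolyvaginProduct W p k n)
    (hcyc : ∀ (ℓ : ℕ) [Fact ℓ.Prime], ℓ ∣ n →
      Nat.card {P : ((WeierstrassCurve.integralModelInt W).map
          (Int.castRingHom (ZMod ℓ))).toAffine.Point // p • P = 0} ≤ p)
    (ψ : (ℓ : ℕ) → (ZMod ℓ)ˣ →* Multiplicative (ZMod (p ^ k)))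
    (hψ : ∀ ℓ ∈ n.primeFactors, Function.Surjective (ψ ℓ))
    (hδ : kuriharaNumber D.f (p ^ k) n ψ ≠ 0) :
    ∃ q : ℚ, shaAn W = (q : ℂ) ∧
      padicValRat p q + padicValNat p W.tamagawaProduct ≤
        padicValNat p W.shaOrder + ((k - 1 : ℕ) : ℤ) := by
  have hr0 : W.analyticRank = 0 := analyticRank_eq_zero_of_entireLFunction_one_ne_zero W hL
  obtain ⟨-, hfin⟩ := hGZK W (by rw [hr0]; exact zero_le_one)
  haveI : Finite W.sha := hfin
  obtain ⟨t, ht, hval⟩ := hKim W p hp5 hsurj hL hfin D hc hper k n hk hn hcyc ψ hψ hδ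
  have hΩC : (W.realPeriodRat : ℂ) ≠ 0 := Complex.ofReal_ne_zero.mpr W.realPeriodRat_pos_holds.ne'
  have ht0 : t ≠ 0 := by
    rintro rfl
    apply hL
    have h := ht
    rw [div_eq_iff hΩC] at h
    rw [h]; simp
  have hirr : W.HasIrreducibleModPGaloisRep p :=
    hasIrreducibleModPGaloisRep_of_hasSurjectiveModNGaloisRep W p hsurj
  have hsha : padicValNat p (Nat.card (AddCommGroup.primaryComponent W.sha p)) =
      padicValNat p W.shaOrder := by
    unfold WeierstrassCurve.shaOrder
    exact padicValNat_card_addPrimaryComponent p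
  refine ⟨t * (W.torsionOrder : ℚ) ^ 2 / (W.tamagawaProduct : ℚ),
    shaAn_eq_of_analyticRank_eq_zero W hGZK hr0 ht, ?_⟩
  rw [padicValRat_shaAn_witness W p hirr ht0, ← hsha]
  linarith

/-- **N10's LOWER half per pair from a level-`k` Kurihara number with `k ≤ ord_p ∏ c_ℓ + 1`**
(rank `0`, `p ≥ 5`, ANY reduction at `p`, `ρ̄_{E,p}` onto; Kim 2026 Thm. 1.8 (6) beyond the unit case
`hKim`, GZK `hGZK`): the certificate of `padicValRat_shaAn_le_of_kimLower` at a level not exceeding the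
Tamagawa level `ord_p ∏ c_ℓ + 1` gives `Typed.MissingLowerBoundAt W p`, i.e. `ord_p #Ш_an ≤ ord_p #Ш`.
For `ord_p ∏ c_ℓ = 0` this is the unit case (`k = 1`); on a row with `t = ord_p ∏ c_ℓ ≥ 1` the
informative certificate has level `t + 1` (by §2 every lower level vanishes once the upper half
holds). Per pair; NOT a class theorem. [cite: Kim2022StructureSelmer, Thm. 1.9 (6) (PDF p. 8) and §1.5.1–1.5.3 (PDF pp. 7–8)]
[cite: Miller2011LMS, Def. 1.1] -/
theorem missingLowerBoundAt_rankZero_of_kimLower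
    (hKim : Kim2026.rankZero_le_padicValNat_sha_of_kuriharaNumber_ne_zero)
    (hGZK : rank_eq_analyticRank_of_analyticRank_le_one) (hp5 : 5 ≤ p)
    (hsurj : Surj W p) (hL : W.entireLFunction 1 ≠ 0)
    {N : ℕ} [NeZero N] (D : ModularParametrizationData W N) (hc : ¬ (p : ℤ) ∣ D.maninConstant)
    (hper : ∃ u : ℚ, ‖(u : ℚ_[p])‖ = 1 ∧ W.realPeriodRat = u * plusPeriod D.f)
    (k n : ℕ) [NeZero n] (hk : 1 ≤ k) (hkt : k ≤ padicValNat p W.tamagawaProduct + 1)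
    (hn : Kato.IsKolyvaginProduct W p k n)
    (hcyc : ∀ (ℓ : ℕ) [Fact ℓ.Prime], ℓ ∣ n →
      Nat.card {P : ((WeierstrassCurve.integralModelInt W).map
          (Int.castRingHom (ZMod ℓ))).toAffine.Point // p • P = 0} ≤ p)
    (ψ : (ℓ : ℕ) → (ZMod ℓ)ˣ →* Multiplicative (ZMod (p ^ k)))
    (hψ : ∀ ℓ ∈ n.primeFactors, Function.Surjective (ψ ℓ))
    (hδ : kuriharaNumber D.f (p ^ k) n ψ ≠ 0) : MissingLowerBoundAt W p := by
  obtain ⟨q, hq, hv⟩ := padicValRat_shaAn_le_of_kimLower W p hKim hGZK hp5 hsurj hL D hc hper k n hk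
    hn hcyc ψ hψ hδ
  refine ⟨q, hq, ?_⟩
  have hkt' : ((k - 1 : ℕ) : ℤ) ≤ (padicValNat p W.tamagawaProduct : ℤ) := by
    have : k - 1 ≤ padicValNat p W.tamagawaProduct := by omega
    exact_mod_cast this
  linarith

/-- **`BSD(E,p)` per pair from a level-`k` Kurihara certificate (`k ≤ ord_p ∏ c_ℓ + 1`) AND any
upper half** (rank `0`, `p ≥ 5`, any reduction at `p`): the two halves make Miller's `BSD(E,p)` in
analytic rank `0` (`Typed.missingPPartAt_of_lower_of_upper`, `Typed.bsdp_of_missingPPartAt`).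
[cite: Kim2022StructureSelmer, Thm. 1.9 (6) (PDF p. 8)] [cite: Miller2011LMS, Def. 1.1] -/
theorem bsdp_rankZero_of_kimLower_of_missingUpperBoundAt
    (hKim : Kim2026.rankZero_le_padicValNat_sha_of_kuriharaNumber_ne_zero)
    (hGZK : rank_eq_analyticRank_of_analyticRank_le_one) (hp5 : 5 ≤ p)
    (hsurj : Surj W p) (hL : W.entireLFunction 1 ≠ 0)
    {N : ℕ} [NeZero N] (D : ModularParametrizationData W N) (hc : ¬ (p : ℤ) ∣ D.maninConstant)
    (hper : ∃ u : ℚ, ‖(u : ℚ_[p])‖ = 1 ∧ W.realPeriodRat = u * plusPeriod D.f)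
    (k n : ℕ) [NeZero n] (hk : 1 ≤ k) (hkt : k ≤ padicValNat p W.tamagawaProduct + 1)
    (hn : Kato.IsKolyvaginProduct W p k n)
    (hcyc : ∀ (ℓ : ℕ) [Fact ℓ.Prime], ℓ ∣ n →
      Nat.card {P : ((WeierstrassCurve.integralModelInt W).map
          (Int.castRingHom (ZMod ℓ))).toAffine.Point // p • P = 0} ≤ p)
    (ψ : (ℓ : ℕ) → (ZMod ℓ)ˣ →* Multiplicative (ZMod (p ^ k)))
    (hψ : ∀ ℓ ∈ n.primeFactors, Function.Surjective (ψ ℓ))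
    (hδ : kuriharaNumber D.f (p ^ k) n ψ ≠ 0)
    (hup : MissingUpperBoundAt W p) : BSDp W p :=
  bsdp_of_missingPPartAt W p hGZK
    (by rw [analyticRank_eq_zero_of_entireLFunction_one_ne_zero W hL]; exact zero_le_one)
    (missingPPartAt_of_lower_of_upper W p
      (missingLowerBoundAt_rankZero_of_kimLower W p hKim hGZK hp5 hsurj hL D hc hper k n hk hkt hn hcyc
        ψ hψ hδ) hup)

/-! ### §2 Vanishing below the Tamagawa level — the kernel prediction for STEP-0 -/

/-- **Granted the UPPER half, every Kurihara number of level `k ≤ ord_p ∏ c_ℓ` vanishes modulo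
`p^k`** (rank `0`, `p ≥ 5`, any reduction at `p`, `ρ̄_{E,p}` onto, Manin datum, period transfer; Kim
2026 Thm. 1.8 (6) beyond the unit case `hKim`, GZK `hGZK`): a non-zero `δ̃_n^{(k)}` would give
`ord_p #Ш ≥ ord_p(L(E,1)/Ω) − (k − 1) ≥ ord_p #Ш_an + 1`, contradicting `MissingUpperBoundAt W p`. The
level-`k` form of additive-p3's `X4.not_kuriharaUnitAt_of_bsdp_of_dvd_tamagawaProduct` (`k = 1`) and
the kernel form, on these rows, of the inequality `∂^{(∞)}(δ̃) ≥ ∑_ℓ ord_p c_ℓ` expected in Kim's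
§1.5.3. What the census instrument (CLASS-CLOSURE-PLAN I-12 at level `p^k`) must observe on every
rank-`0` pair carrying a kernel upper half. [cite: Kim2022StructureSelmer, Thm. 1.9 (6) (PDF p. 8) and §1.5.3 (PDF p. 8)]
[cite: Miller2011LMS, Def. 1.1] -/
theorem kuriharaNumber_eq_zero_of_missingUpperBoundAt_of_le_tamagawa
    (hKim : Kim2026.rankZero_le_padicValNat_sha_of_kuriharaNumber_ne_zero)
    (hGZK : rank_eq_analyticRank_of_analyticRank_le_one) (hp5 : 5 ≤ p)
    (hsurj : Surj W p) (hL : W.entireLFunction 1 ≠ 0) (hup : MissingUpperBoundAt W p)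
    {N : ℕ} [NeZero N] (D : ModularParametrizationData W N) (hc : ¬ (p : ℤ) ∣ D.maninConstant)
    (hper : ∃ u : ℚ, ‖(u : ℚ_[p])‖ = 1 ∧ W.realPeriodRat = u * plusPeriod D.f)
    (k n : ℕ) [NeZero n] (hk : 1 ≤ k) (hkt : k ≤ padicValNat p W.tamagawaProduct)
    (hn : Kato.IsKolyvaginProduct W p k n)
    (hcyc : ∀ (ℓ : ℕ) [Fact ℓ.Prime], ℓ ∣ n →
      Nat.card {P : ((WeierstrassCurve.integralModelInt W).map
          (Int.castRingHom (ZMod ℓ))).toAffine.Point // p • P = 0} ≤ p)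
    (ψ : (ℓ : ℕ) → (ZMod ℓ)ˣ →* Multiplicative (ZMod (p ^ k)))
    (hψ : ∀ ℓ ∈ n.primeFactors, Function.Surjective (ψ ℓ)) :
    kuriharaNumber D.f (p ^ k) n ψ = 0 := by
  by_contra hδ
  obtain ⟨q, hq, hv⟩ := padicValRat_shaAn_le_of_kimLower W p hKim hGZK hp5 hsurj hL D hc hper k n hk
    hn hcyc ψ hψ hδ
  obtain ⟨q', hq', hv'⟩ := hup
  have hqq : q' = q := by exact_mod_cast hq'.symm.trans hq
  subst hqq
  have hkt' : ((k - 1 : ℕ) : ℤ) + 1 ≤ (padicValNat p W.tamagawaProduct : ℤ) := by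
    have : k - 1 + 1 ≤ padicValNat p W.tamagawaProduct := by omega
    exact_mod_cast this
  linarith

/-! ### §3 Sanity: at level `1` the new fact and the certificate-free upper bound return the unit fact -/

/-- **Consistency of the three Kim facts at `k = 1`**: the level-`k` lower reading (`hKim`) at `k = 1`
together with the certificate-free upper bound `Kim2026.rankZero_padicValNat_sha_le_of_maninConstant`
(`hKimU`) yields `ord_p(L(E,1)/Ω(W)) = ord_p #Ш(E)(p)` — the conclusion of the unit fact
`Kim2022_rankZero_padicValRat_sha_of_kuriharaNumber_ne_zero_of_maninConstant` — from a unit Kurihara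
number. Bookkeeping (uniqueness of the rational value of `L(E,1)/Ω`). [cite: Kim2022StructureSelmer, Thm. 1.9 (6) (PDF p. 8)] -/
theorem padicValRat_eq_of_kimLower_one_of_kimUpper
    (hKim : Kim2026.rankZero_le_padicValNat_sha_of_kuriharaNumber_ne_zero)
    (hKimU : Kim2026.rankZero_padicValNat_sha_le_of_maninConstant) (hp5 : 5 ≤ p)
    (hsurj : Surj W p) (hL : W.entireLFunction 1 ≠ 0) (hfin : Finite W.sha)
    {N : ℕ} [NeZero N] (D : ModularParametrizationData W N) (hc : ¬ (p : ℤ) ∣ D.maninConstant)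
    (hper : ∃ u : ℚ, ‖(u : ℚ_[p])‖ = 1 ∧ W.realPeriodRat = u * plusPeriod D.f)
    (n : ℕ) [NeZero n] (hn : Kato.IsKolyvaginProduct W p 1 n)
    (hcyc : ∀ (ℓ : ℕ) [Fact ℓ.Prime], ℓ ∣ n →
      Nat.card {P : ((WeierstrassCurve.integralModelInt W).map
          (Int.castRingHom (ZMod ℓ))).toAffine.Point // p • P = 0} ≤ p)
    (ψ : (ℓ : ℕ) → (ZMod ℓ)ˣ →* Multiplicative (ZMod (p ^ 1)))
    (hψ : ∀ ℓ ∈ n.primeFactors, Function.Surjective (ψ ℓ))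
    (hδ : kuriharaNumber D.f (p ^ 1) n ψ ≠ 0) :
    ∃ q : ℚ, W.entireLFunction 1 / (W.realPeriodRat : ℂ) = (q : ℂ) ∧
      padicValRat p q = (padicValNat p (Nat.card (AddCommGroup.primaryComponent W.sha p)) : ℤ) := by
  obtain ⟨q, hq, hle⟩ := hKim W p hp5 hsurj hL hfin D hc hper 1 n le_rfl hn hcyc ψ hψ hδ
  obtain ⟨q', hq', hge⟩ := hKimU W p hp5 hsurj hL hfin D hc
  have hqq : q' = q := by exact_mod_cast hq'.symm.trans hq
  subst hqq
  refine ⟨q', hq, le_antisymm ?_ hge⟩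
  simpa using hle

/-! ### §4 Class readings on N10's loci at `p ≥ 5` -/

/-- **X4(M) ∧ `r_an = 0` ∧ surj(p), `p ≥ 5`: `BSD(E,p)` per pair from ONE Kurihara number of level
`k ≤ ord_p ∏ c_ℓ + 1`** — the Tamagawa-obstructed (M) rows INCLUDED (where no unit Kurihara number
exists). Upper half CLASS-WIDE from additive-p1's `ClassX4M.bsdp_rankZero_of_surj_of_lower` (Delbourgo
1998 Prop. 4 `hDel`, Wuthrich Lemma 20 `hL20`, Kato's half-eigen divisibility `hKato`, modular
parametrisation data `hmodD`, GZK, modularity); lower half from §1 (Kim `hKim` + the certificate).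
Per pair; X4(M) stays CONSTRUCTION-SHAPED; nothing booked. [cite: Kim2022StructureSelmer, Thm. 1.9 (6) (PDF p. 8)]
[cite: Delbourgo1998, Prop. 4 (p. 144)] [cite: Wuthrich2014, Lemma 20 (p. 399), Cor. 19 (p. 398)] -/
theorem ClassX4M.bsdp_rankZero_of_kimLower
    (hKim : Kim2026.rankZero_le_padicValNat_sha_of_kuriharaNumber_ne_zero)
    (hDel : Delbourgo1998.prop4_rankZero_pow_dvd_constantCoeff)
    (hGZK : rank_eq_analyticRank_of_analyticRank_le_one) (hmod : hasEntireLFunction_rat)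
    (hmodD : nonempty_modularParametrizationData)
    (hL20 : Wuthrich2014.lemma20_surjective_threeAdic_of_semistable)
    (hKato : Wuthrich2014.kato_halfEigenCharIdeal_dvd_cyclotomicPrime_of_surjective)
    (hX : ClassX4M W p) (hr : W.analyticRank = 0) (hsurj : Surj W p) (hp5 : 5 ≤ p)
    {N : ℕ} [NeZero N] (D : ModularParametrizationData W N) (hc : ¬ (p : ℤ) ∣ D.maninConstant)
    (hper : ∃ u : ℚ, ‖(u : ℚ_[p])‖ = 1 ∧ W.realPeriodRat = u * plusPeriod D.f)
    (k n : ℕ) [NeZero n] (hk : 1 ≤ k) (hkt : k ≤ padicValNat p W.tamagawaProduct + 1)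
    (hn : Kato.IsKolyvaginProduct W p k n)
    (hcyc : ∀ (ℓ : ℕ) [Fact ℓ.Prime], ℓ ∣ n →
      Nat.card {P : ((WeierstrassCurve.integralModelInt W).map
          (Int.castRingHom (ZMod ℓ))).toAffine.Point // p • P = 0} ≤ p)
    (ψ : (ℓ : ℕ) → (ZMod ℓ)ˣ →* Multiplicative (ZMod (p ^ k)))
    (hψ : ∀ ℓ ∈ n.primeFactors, Function.Surjective (ψ ℓ))
    (hδ : kuriharaNumber D.f (p ^ k) n ψ ≠ 0) : BSDp W p := by
  have hL : W.entireLFunction 1 ≠ 0 := by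
    rw [← W.leadingLCoeff_eq_of_analyticRank_eq_zero hr]
    exact W.leadingLCoeff_ne_zero_holds (hmod W)
  exact ClassX4M.bsdp_rankZero_of_surj_of_lower hDel hGZK hmod hmodD hL20 hKato hX hr hsurj
    (missingLowerBoundAt_rankZero_of_kimLower W p hKim hGZK hp5 hsurj hL D hc hper k n hk hkt hn hcyc
      ψ hψ hδ)

/-- **X4(M) ∧ `r_an = 0` ∧ surj(p), `p ≥ 5`: every Kurihara number of level `k ≤ ord_p ∏ c_ℓ`
vanishes modulo `p^k`** — §2 with the upper half DISCHARGED class-wide by additive-p1's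
`ClassX4M.missingUpperBoundAt_rankZero_of_surj`. A falsifiable prediction on every (M) row with
`p ∣ ∏ c_ℓ` (granted the named facts). [cite: Kim2022StructureSelmer, Thm. 1.9 (6) and §1.5.3 (PDF p. 8)]
[cite: Delbourgo1998, Prop. 4 (p. 144)] [cite: Wuthrich2014, Lemma 20 (p. 399), Cor. 19 (p. 398)] -/
theorem ClassX4M.kuriharaNumber_eq_zero_of_le_tamagawa
    (hKim : Kim2026.rankZero_le_padicValNat_sha_of_kuriharaNumber_ne_zero)
    (hDel : Delbourgo1998.prop4_rankZero_pow_dvd_constantCoeff)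
    (hGZK : rank_eq_analyticRank_of_analyticRank_le_one) (hmod : hasEntireLFunction_rat)
    (hmodD : nonempty_modularParametrizationData)
    (hL20 : Wuthrich2014.lemma20_surjective_threeAdic_of_semistable)
    (hKato : Wuthrich2014.kato_halfEigenCharIdeal_dvd_cyclotomicPrime_of_surjective)
    (hX : ClassX4M W p) (hr : W.analyticRank = 0) (hsurj : Surj W p) (hp5 : 5 ≤ p)
    {N : ℕ} [NeZero N] (D : ModularParametrizationData W N) (hc : ¬ (p : ℤ) ∣ D.maninConstant)
    (hper : ∃ u : ℚ, ‖(u : ℚ_[p])‖ = 1 ∧ W.realPeriodRat = u * plusPeriod D.f)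
    (k n : ℕ) [NeZero n] (hk : 1 ≤ k) (hkt : k ≤ padicValNat p W.tamagawaProduct)
    (hn : Kato.IsKolyvaginProduct W p k n)
    (hcyc : ∀ (ℓ : ℕ) [Fact ℓ.Prime], ℓ ∣ n →
      Nat.card {P : ((WeierstrassCurve.integralModelInt W).map
          (Int.castRingHom (ZMod ℓ))).toAffine.Point // p • P = 0} ≤ p)
    (ψ : (ℓ : ℕ) → (ZMod ℓ)ˣ →* Multiplicative (ZMod (p ^ k)))
    (hψ : ∀ ℓ ∈ n.primeFactors, Function.Surjective (ψ ℓ)) :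
    kuriharaNumber D.f (p ^ k) n ψ = 0 := by
  have hL : W.entireLFunction 1 ≠ 0 := by
    rw [← W.leadingLCoeff_eq_of_analyticRank_eq_zero hr]
    exact W.leadingLCoeff_ne_zero_holds (hmod W)
  exact kuriharaNumber_eq_zero_of_missingUpperBoundAt_of_le_tamagawa W p hKim hGZK hp5 hsurj hL
    (ClassX4M.missingUpperBoundAt_rankZero_of_surj hDel hGZK hmod hmodD hL20 hKato hX hr hsurj)
    D hc hper k n hk hkt hn hcyc ψ hψ

/-- **X4♯(G-ord) ∩ `I₀*` (`e = 2`) ∧ `r_an = 0` ∧ surj(p), `p ≥ 5`: `BSD(E,p)` per pair from ONE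
Kurihara number of level `k ≤ ord_p ∏ c_ℓ + 1`.** Upper half from additive-p2's
`ClassX4Gord.bsdp_rankZero_of_katoComponent_of_lower` (Kato's divisibility on the `ω^{(p−1)/2}`
component `hK`, Delbourgo Prop. 4 `hDel`, `hmodD`, GZK, modularity; its `p = 3 → Ram` binder is vacuous
at `p ≥ 5`); lower half from §1. Per pair; X4♯(G-ord) stays CONSTRUCTION-SHAPED; nothing booked.
[cite: Kim2022StructureSelmer, Thm. 1.9 (6) (PDF p. 8)] [cite: Kato2004Asterisque, Thm. 17.4 (3) (p. 273)]
[cite: Delbourgo1998, Prop. 4 (p. 144)] -/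
theorem ClassX4Gord.bsdp_rankZero_of_kimLower
    (hKim : Kim2026.rankZero_le_padicValNat_sha_of_kuriharaNumber_ne_zero)
    (hK : Kato2004.charIdeal_dvd_padicLFunctionBranch_component_of_surjective)
    (hDel : Delbourgo1998.prop4_rankZero_pow_dvd_constantCoeff)
    (hGZK : rank_eq_analyticRank_of_analyticRank_le_one) (hmod : hasEntireLFunction_rat)
    (hmodD : nonempty_modularParametrizationData)
    (hX : ClassX4Gord W p) (he : semistabilityIndex W p = 2) (hr : W.analyticRank = 0)
    (hsurj : Surj W p) (hp5 : 5 ≤ p)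
    {N : ℕ} [NeZero N] (D : ModularParametrizationData W N) (hc : ¬ (p : ℤ) ∣ D.maninConstant)
    (hper : ∃ u : ℚ, ‖(u : ℚ_[p])‖ = 1 ∧ W.realPeriodRat = u * plusPeriod D.f)
    (k n : ℕ) [NeZero n] (hk : 1 ≤ k) (hkt : k ≤ padicValNat p W.tamagawaProduct + 1)
    (hn : Kato.IsKolyvaginProduct W p k n)
    (hcyc : ∀ (ℓ : ℕ) [Fact ℓ.Prime], ℓ ∣ n →
      Nat.card {P : ((WeierstrassCurve.integralModelInt W).map
          (Int.castRingHom (ZMod ℓ))).toAffine.Point // p • P = 0} ≤ p)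
    (ψ : (ℓ : ℕ) → (ZMod ℓ)ˣ →* Multiplicative (ZMod (p ^ k)))
    (hψ : ∀ ℓ ∈ n.primeFactors, Function.Surjective (ψ ℓ))
    (hδ : kuriharaNumber D.f (p ^ k) n ψ ≠ 0) : BSDp W p := by
  have hL : W.entireLFunction 1 ≠ 0 := by
    rw [← W.leadingLCoeff_eq_of_analyticRank_eq_zero hr]
    exact W.leadingLCoeff_ne_zero_holds (hmod W)
  exact ClassX4Gord.bsdp_rankZero_of_katoComponent_of_lower hK hDel hGZK hmod hmodD hX he hr hsurj
    (fun h3 => absurd h3 (by omega))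
    (missingLowerBoundAt_rankZero_of_kimLower W p hKim hGZK hp5 hsurj hL D hc hper k n hk hkt hn hcyc
      ψ hψ hδ)

/-- **X4♯(G-ord) ∩ `I₀*` (`e = 2`) ∧ `r_an = 0` ∧ surj(p), `p ≥ 5`: every Kurihara number of level
`k ≤ ord_p ∏ c_ℓ` vanishes modulo `p^k`** — §2 with the upper half DISCHARGED by additive-p2's
`ClassX4Gord.missingUpperBoundAt_rankZero_of_katoComponent_of_towerSurj` (tower from Serre at
`p ≥ 5`). [cite: Kim2022StructureSelmer, Thm. 1.9 (6) and §1.5.3 (PDF p. 8)] [cite: Kato2004Asterisque, Thm. 17.4 (3) (p. 273)]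
[cite: Delbourgo1998, Prop. 4 (p. 144)] -/
theorem ClassX4Gord.kuriharaNumber_eq_zero_of_le_tamagawa
    (hKim : Kim2026.rankZero_le_padicValNat_sha_of_kuriharaNumber_ne_zero)
    (hK : Kato2004.charIdeal_dvd_padicLFunctionBranch_component_of_surjective)
    (hDel : Delbourgo1998.prop4_rankZero_pow_dvd_constantCoeff)
    (hGZK : rank_eq_analyticRank_of_analyticRank_le_one) (hmod : hasEntireLFunction_rat)
    (hmodD : nonempty_modularParametrizationData)
    (hX : ClassX4Gord W p) (he : semistabilityIndex W p = 2) (hr : W.analyticRank = 0)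
    (hsurj : Surj W p) (hp5 : 5 ≤ p)
    {N : ℕ} [NeZero N] (D : ModularParametrizationData W N) (hc : ¬ (p : ℤ) ∣ D.maninConstant)
    (hper : ∃ u : ℚ, ‖(u : ℚ_[p])‖ = 1 ∧ W.realPeriodRat = u * plusPeriod D.f)
    (k n : ℕ) [NeZero n] (hk : 1 ≤ k) (hkt : k ≤ padicValNat p W.tamagawaProduct)
    (hn : Kato.IsKolyvaginProduct W p k n)
    (hcyc : ∀ (ℓ : ℕ) [Fact ℓ.Prime], ℓ ∣ n →
      Nat.card {P : ((WeierstrassCurve.integralModelInt W).map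
          (Int.castRingHom (ZMod ℓ))).toAffine.Point // p • P = 0} ≤ p)
    (ψ : (ℓ : ℕ) → (ZMod ℓ)ˣ →* Multiplicative (ZMod (p ^ k)))
    (hψ : ∀ ℓ ∈ n.primeFactors, Function.Surjective (ψ ℓ)) :
    kuriharaNumber D.f (p ^ k) n ψ = 0 := by
  have hL : W.entireLFunction 1 ≠ 0 := by
    rw [← W.leadingLCoeff_eq_of_analyticRank_eq_zero hr]
    exact W.leadingLCoeff_ne_zero_holds (hmod W)
  have htower : ∀ m : ℕ, W.HasSurjectiveModNGaloisRep (p ^ m : ℕ) :=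
    serre_hasSurjectiveModNGaloisRep_pow_holds W p hp5 hsurj
  exact kuriharaNumber_eq_zero_of_missingUpperBoundAt_of_le_tamagawa W p hKim hGZK hp5 hsurj hL
    (ClassX4Gord.missingUpperBoundAt_rankZero_of_katoComponent_of_towerSurj hK hDel hGZK hmod hmodD
      hX he hr htower)
    D hc hper k n hk hkt hn hcyc ψ hψ

end Summit.BirchSwinnertonDyer.Rank1Residual.X4

end
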